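import Summits.AnomalousDissipation.AnomalousDissipation.Theorems.DopplerClockQuadratureStressFloorPerturbationEnergyBalance
import Summits.AnomalousDissipation.AnomalousDissipation.Theorems.DopplerClockQuadratureStressFloorPatternTransportFacts
import Summits.AnomalousDissipation.AnomalousDissipation.Theorems.DopplerClockLaminarStreaks
import Literature.Analysis.FluidPDE.TorusClassicalLerayHopfProofs
import Literature.Analysis.FluidPDE.AlexakisDoeringProofs

/-!
# Stub `stub_kinematicExtraction` of the line `Sketch` (laminar-burst-shadowing)
# (crux stmt-AnomalousDissipation-18129, `DopplerClock.QuadratureStressFloor`)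

KINEMATIC EXTRACTION — the card's first lemma. Let `u_L = V e₂ + aΨ_c + bΨ_s` be the laminar
streak array of the swept Doppler pair `f = F sin(2πm x₁) cos(2πn x₂) e₀`
(`Ψ_c = sin(2πm x₁) cos(2πn x₂) e₀`, `Ψ_s = sin(2πm x₁) sin(2πn x₂) e₀`, `a = Fνκ²/D`,
`b = FV(2πn)/D`, `D = V²(2πn)² + ν²κ⁴`; item `LaminarStreaks`, `dopplerClock_laminarStreaks_proof`),
and let `(u, p)` be a classical solution of `NS_ν(f)` on a convex time set `S ⊇ [t₁, t₂]`. With the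
perturbation `w' = u − u_L`, its energy `E'(t) = ½‖w'(t)‖₂²` and the drift perturbation
`w = u − V e₂ = w' + aΨ_c + bΨ_s`,

  `E'(t₂) − E'(t₁) − a ∫_{t₁}^{t₂} (C₁ E' + C₂ √E') ≤ b ∫_{t₁}^{t₂} (−T_s(w))`,
  `T_s(w) = ∫ ⟪w, (w·∇)Ψ_s⟫`,

with `C₁ = 4π(m+n)`, `C₂ = √2 · 2π(m+n) · F/(2πnV)` depending on the design only.

**Proof.** (1) Serrin's identity (`stub_perturbationEnergyBalance` with `U = u_L`, `q = 0`):
`d/dt E' = −ν‖∇w'‖₂² − ∫⟪w', (w'·∇)u_L⟫` within `S`. (2) `(w'·∇)u_L = a(w'·∇)Ψ_c + b(w'·∇)Ψ_s`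
(linearity of `Torus.fderiv` in the differentiated field; the drift `V e₂` is constant), so the
flux is `−ν‖∇w'‖² − aT_c(w') − bT_s(w')`. (3) By the pattern transport facts
(`stub_patternTransportFacts`): `(w·∇)Ψ_s = (w'·∇)Ψ_s`, hence
`T_s(w) = T_s(w') + a∫⟪Ψ_c,(w'·∇)Ψ_s⟫ + b·0`, and `|T_c(w')| ≤ 2π(m+n)·2E'`,
`|∫⟪Ψ_c,(w'·∇)Ψ_s⟫| ≤ 2π(m+n)∫‖w'‖ ≤ 2π(m+n)√2·√E'` (Cauchy–Schwarz on the probability space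
`T³`), while `0 ≤ a` and `0 ≤ b ≤ F/(2πnV)`. So
`d/dt E' ≤ b(−T_s(w)) + a(C₁E' + C₂√E')`. (4) Integrate over `[t₁, t₂]`
(`intervalIntegral.sub_le_integral_of_hasDeriv_right_of_le`; the right-hand side is continuous in
time by joint smoothness, `Torus.IsSmoothSpaceTimeOn.continuousOn_integral`).

The analytic core is proved for an abstract steady state `U = c + aΦ + bΨ` and abstract pattern
transport bounds with constant `K` (`KinematicExtraction.flux_le`, `KinematicExtraction.integrated`);
the registered statement is the instance `c = V e₂`, `Φ = Ψ_c`, `Ψ = Ψ_s`, `K = 2π(m+n)`.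

References: J. Serrin, Arch. Rational Mech. Anal. 3 (1959), §2 (energy identity of the
energy-stability method); Doering–Gibbon 1995, Ch. 2; Majda–Bertozzi 2002, Prop. 3.1. No new
definitions; no named facts.
-/

noncomputable section

-- `Summit.<Summit>.<Problem>` is the tree's mandated summit-side namespace (CONVENTIONS §2); for
-- this single-conjunct summit the two coincide, so the duplicate is deliberate.
set_option linter.dupNamespace false

open MeasureTheory Set Filter Topology UnitAddTorus
open scoped InnerProductSpace RealInnerProductSpace

namespace Summit.AnomalousDissipation.AnomalousDissipation.Theorems

open Literature.Analysis.FluidPDE Literature.Analysis.FluidPDE.Torus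
open Literature.Analysis.FunctionSpaces Literature.Analysis.FunctionSpaces.Torus

namespace KinematicExtraction

variable {ν K B a b : ℝ} {c : EuclideanSpace ℝ (Fin 3)}
  {Φ Ψ U f : UnitAddTorus (Fin 3) → EuclideanSpace ℝ (Fin 3)} {q : UnitAddTorus (Fin 3) → ℝ}
  {S : Set ℝ} {u : ℝ → UnitAddTorus (Fin 3) → EuclideanSpace ℝ (Fin 3)}
  {p : ℝ → UnitAddTorus (Fin 3) → ℝ}

/-- **The perturbation flux about `U = c + aΦ + bΨ` is controlled by the quadrature stress.**
Let `(U, q)` be a steady classical solution of `NS_ν(f)` of the form `U = c + aΦ + bΨ` (`c` a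
constant drift, `Φ`, `Ψ` smooth patterns, `a, b ≥ 0`, `b ≤ B`) and `(u, p)` a classical solution of
the same system on `S`. Assume the pattern transport facts with constant `K ≥ 0` for every smooth
divergence-free `w`: `∫⟪Ψ,(w·∇)Ψ⟫ = 0`, `|∫⟪Φ,(w·∇)Ψ⟫| ≤ K∫‖w‖`, `|∫⟪w,(w·∇)Φ⟫| ≤ K∫‖w‖²`,
`((w + a'Φ + b'Ψ)·∇)Ψ = (w·∇)Ψ`. Then, with `w' = u(t) − U`, `E' = ½‖w'‖₂²`, `w = u(t) − c`,
`−ν‖∇w'‖₂² − ∫⟪w',(w'·∇)U⟫ ≤ b(−∫⟪w,(w·∇)Ψ⟫) + a(2K·E' + BK√2·√E')`: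
`(w'·∇)U = a(w'·∇)Φ + b(w'·∇)Ψ`, `∫⟪w,(w·∇)Ψ⟫ = ∫⟪w',(w'·∇)Ψ⟫ + a∫⟪Φ,(w'·∇)Ψ⟫`,
`∫‖w'‖ ≤ √(∫‖w'‖²) = √2√E'` (Serrin 1959, §2; Majda–Bertozzi 2002, Prop. 3.1). [folklore] -/
theorem flux_le (hν : 0 ≤ ν) (hK : 0 ≤ K) (ha : 0 ≤ a) (hb : 0 ≤ b) (hbB : b ≤ B)
    (hΦ : IsSmooth Φ) (hΨ : IsSmooth Ψ)
    (hPT : ∀ w : UnitAddTorus (Fin 3) → EuclideanSpace ℝ (Fin 3), IsSmooth w → IsDivFree w →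
      (∫ x, ⟪Ψ x, convect w Ψ x⟫ = 0) ∧ (|∫ x, ⟪Φ x, convect w Ψ x⟫| ≤ K * ∫ x, ‖w x‖) ∧
      (|∫ x, ⟪w x, convect w Φ x⟫| ≤ K * ∫ x, ‖w x‖ ^ 2) ∧
      (∀ a b : ℝ, convect (fun y => w y + (a • Φ y + b • Ψ y)) Ψ = convect w Ψ))
    (hUeq : ∀ x, U x = c + (a • Φ x + b • Ψ x))
    (hU : IsClassicalNSSolutionOn univ ν (fun _ => f) (fun _ => U) (fun _ => q))
    (hu : IsClassicalNSSolutionOn S ν (fun _ => f) u p) {t : ℝ} (ht : t ∈ S) :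
    -(ν * gradNormSq (fun x => u t x - U x)) -
        ∫ x, ⟪u t x - U x, convect (fun y => u t y - U y) U x⟫ ≤
      b * -(∫ x, ⟪u t x - c, convect (fun y => u t y - c) Ψ x⟫) +
        a * (2 * K * kineticEnergy (fun x => u t x - U x) +
          B * K * Real.sqrt 2 * Real.sqrt (kineticEnergy (fun x => u t x - U x))) := by
  -- the perturbation `w' = u(t) − U` is smooth and divergence free
  have hut : IsSmooth (u t) := hu.smooth_velocity.isSmooth_slice ht
  have hUs : IsSmooth U := hU.smooth_velocity.isSmooth_slice (mem_univ t)
  have hw : IsSmooth (fun x => u t x - U x) := hut.sub hUs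
  have hdiv : IsDivFree (fun x => u t x - U x) := by
    intro x
    have e : (fun y => u t y - U y) = u t - U := rfl
    rw [e, divergence_sub (hut.isContDiff (by simp)) (hUs.isContDiff (by simp)), hu.divFree t ht x,
      hU.divFree t (mem_univ t) x, sub_zero]
  obtain ⟨h1, h2, h3, h4⟩ := hPT _ hw hdiv
  have hΦ1 : IsContDiff 1 Φ := hΦ.isContDiff (by simp)
  have hΨ1 : IsContDiff 1 Ψ := hΨ.isContDiff (by simp)
  -- (2): `(w'·∇)U = a (w'·∇)Φ + b (w'·∇)Ψ`
  have hUfun : U = (fun _ => c) + (a • Φ + b • Ψ) := funext fun x => by simp [hUeq x]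
  have hfd : ∀ (x : UnitAddTorus (Fin 3)) (v : EuclideanSpace ℝ (Fin 3)),
      Torus.fderiv U x v = a • Torus.fderiv Φ x v + b • Torus.fderiv Ψ x v := by
    intro x v
    have h0 : Torus.fderiv (fun _ : UnitAddTorus (Fin 3) => c) x = 0 := fderiv_const_apply c
    rw [hUfun, Torus.fderiv_add (isContDiff_const c) ((hΦ1.smul a).add (hΨ1.smul b)),
      Torus.fderiv_add (hΦ1.smul a) (hΨ1.smul b), Torus.fderiv_const_smul hΦ1,
      Torus.fderiv_const_smul hΨ1, h0, zero_add]
    rfl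
  have hconvU : ∀ x, convect (fun y => u t y - U y) U x =
      a • convect (fun y => u t y - U y) Φ x + b • convect (fun y => u t y - U y) Ψ x :=
    fun x => hfd x _
  have hIΦ' : Integrable (fun x => ⟪u t x - U x, convect (fun y => u t y - U y) Φ x⟫) volume :=
    (hw.inner (hw.convect hΦ)).integrable
  have hIΨ' : Integrable (fun x => ⟪u t x - U x, convect (fun y => u t y - U y) Ψ x⟫) volume :=
    (hw.inner (hw.convect hΨ)).integrable
  have hsplit : ∫ x, ⟪u t x - U x, convect (fun y => u t y - U y) U x⟫ =
      a * (∫ x, ⟪u t x - U x, convect (fun y => u t y - U y) Φ x⟫) +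
        b * (∫ x, ⟪u t x - U x, convect (fun y => u t y - U y) Ψ x⟫) := by
    simp_rw [hconvU, inner_add_right, real_inner_smul_right]
    rw [integral_add (hIΦ'.const_mul a) (hIΨ'.const_mul b), integral_const_mul, integral_const_mul]
  -- (3): the quadrature flux of `w = u(t) − c = w' + aΦ + bΨ`
  have hwpt : ∀ y, u t y - c = (u t y - U y) + (a • Φ y + b • Ψ y) := fun y => by
    rw [hUeq y]; abel
  have hwfun : (fun y => u t y - c) = fun y => (u t y - U y) + (a • Φ y + b • Ψ y) := funext hwpt
  have hIΦ : Integrable (fun x => ⟪Φ x, convect (fun y => u t y - U y) Ψ x⟫) volume :=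
    (hΦ.inner (hw.convect hΨ)).integrable
  have hIΨ : Integrable (fun x => ⟪Ψ x, convect (fun y => u t y - U y) Ψ x⟫) volume :=
    (hΨ.inner (hw.convect hΨ)).integrable
  have hI2 : Integrable (fun x => a * ⟪Φ x, convect (fun y => u t y - U y) Ψ x⟫ +
      b * ⟪Ψ x, convect (fun y => u t y - U y) Ψ x⟫) volume :=
    (hIΦ.const_mul a).add (hIΨ.const_mul b)
  have hTs : ∫ x, ⟪u t x - c, convect (fun y => u t y - c) Ψ x⟫ =
      (∫ x, ⟪u t x - U x, convect (fun y => u t y - U y) Ψ x⟫) +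
        a * (∫ x, ⟪Φ x, convect (fun y => u t y - U y) Ψ x⟫) := by
    rw [hwfun, h4 a b]
    simp_rw [hwpt, inner_add_left, real_inner_smul_left]
    rw [integral_add hIΨ' hI2, integral_add (hIΦ.const_mul a) (hIΨ.const_mul b),
      integral_const_mul, integral_const_mul, h1, mul_zero, add_zero]
  -- sizes: `∫‖w'‖² = 2E'`, `∫‖w'‖ ≤ √2 √E'`
  have hE2 : ∫ x, ‖u t x - U x‖ ^ 2 = 2 * kineticEnergy (fun x => u t x - U x) := by
    simp only [kineticEnergy]
    ring
  have hJ : ∫ x, ‖u t x - U x‖ ≤ Real.sqrt 2 * Real.sqrt (kineticEnergy (fun x => u t x - U x)) := by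
    have h : ∫ x, ‖u t x - U x‖ ≤ Real.sqrt (∫ x, ‖u t x - U x‖ ^ 2) :=
      integral_norm_le_sqrt_integral_norm_sq (hw.memLp 2)
    rw [hE2, Real.sqrt_mul (by norm_num : (0 : ℝ) ≤ 2)] at h
    exact h
  have h2' : |∫ x, ⟪Φ x, convect (fun y => u t y - U y) Ψ x⟫| ≤ K * ∫ x, ‖u t x - U x‖ := h2
  have h3' : |∫ x, ⟪u t x - U x, convect (fun y => u t y - U y) Φ x⟫| ≤
      K * ∫ x, ‖u t x - U x‖ ^ 2 := h3
  -- `−a T_c(w') ≤ a · 2K E'`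
  have i1 : a * -(∫ x, ⟪u t x - U x, convect (fun y => u t y - U y) Φ x⟫) ≤
      a * (2 * K * kineticEnergy (fun x => u t x - U x)) := by
    refine mul_le_mul_of_nonneg_left ?_ ha
    have h := neg_le_abs (∫ x, ⟪u t x - U x, convect (fun y => u t y - U y) Φ x⟫)
    rw [hE2] at h3'
    linarith
  -- `a b ∫⟪Φ,(w'·∇)Ψ⟫ ≤ a · B K √2 √E'`
  have i2 : a * (b * ∫ x, ⟪Φ x, convect (fun y => u t y - U y) Ψ x⟫) ≤
      a * (B * K * Real.sqrt 2 * Real.sqrt (kineticEnergy (fun x => u t x - U x))) := by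
    refine mul_le_mul_of_nonneg_left ?_ ha
    have hl : ∫ x, ⟪Φ x, convect (fun y => u t y - U y) Ψ x⟫ ≤
        K * (Real.sqrt 2 * Real.sqrt (kineticEnergy (fun x => u t x - U x))) :=
      (le_abs_self _).trans (h2'.trans (mul_le_mul_of_nonneg_left hJ hK))
    have h0 : 0 ≤ K * (Real.sqrt 2 * Real.sqrt (kineticEnergy (fun x => u t x - U x))) := by
      positivity
    linarith [mul_le_mul_of_nonneg_left hl hb, mul_le_mul_of_nonneg_right hbB h0]
  have hG : 0 ≤ ν * gradNormSq (fun x => u t x - U x) := mul_nonneg hν (gradNormSq_nonneg _)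
  rw [hsplit, hTs]
  linarith [i1, i2, hG]

/-- **Kinematic extraction, abstract form.** Under the hypotheses of `flux_le`, for a convex time
set `S ⊇ [t₁, t₂]`:
`E'(t₂) − E'(t₁) − a∫_{t₁}^{t₂}(2K·E' + BK√2·√E') ≤ b∫_{t₁}^{t₂}(−∫⟪w,(w·∇)Ψ⟫)`, `E' = ½‖u − U‖₂²`,
`w = u − c`: the perturbation energy has the flux of Serrin's identity
(`stub_perturbationEnergyBalance`) as one-sided derivative within `S`, bounded by `flux_le`, and the
bound integrates (`intervalIntegral.sub_le_integral_of_hasDeriv_right_of_le`; the majorant is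
continuous in time by joint smoothness). [folklore] -/
theorem integrated (hν : 0 ≤ ν) (hK : 0 ≤ K) (ha : 0 ≤ a) (hb : 0 ≤ b) (hbB : b ≤ B)
    (hΦ : IsSmooth Φ) (hΨ : IsSmooth Ψ)
    (hPT : ∀ w : UnitAddTorus (Fin 3) → EuclideanSpace ℝ (Fin 3), IsSmooth w → IsDivFree w →
      (∫ x, ⟪Ψ x, convect w Ψ x⟫ = 0) ∧ (|∫ x, ⟪Φ x, convect w Ψ x⟫| ≤ K * ∫ x, ‖w x‖) ∧
      (|∫ x, ⟪w x, convect w Φ x⟫| ≤ K * ∫ x, ‖w x‖ ^ 2) ∧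
      (∀ a b : ℝ, convect (fun y => w y + (a • Φ y + b • Ψ y)) Ψ = convect w Ψ))
    (hUeq : ∀ x, U x = c + (a • Φ x + b • Ψ x))
    (hU : IsClassicalNSSolutionOn univ ν (fun _ => f) (fun _ => U) (fun _ => q))
    (hu : IsClassicalNSSolutionOn S ν (fun _ => f) u p) {t₁ t₂ : ℝ} (ht : t₁ ≤ t₂)
    (hS : Convex ℝ S) (hI : Icc t₁ t₂ ⊆ S) :
    kineticEnergy (fun x => u t₂ x - U x) - kineticEnergy (fun x => u t₁ x - U x) -
        a * ∫ t in t₁..t₂, (2 * K * kineticEnergy (fun x => u t x - U x) +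
          B * K * Real.sqrt 2 * Real.sqrt (kineticEnergy (fun x => u t x - U x))) ≤
      b * ∫ t in t₁..t₂, -(∫ x, ⟪u t x - c, convect (fun y => u t y - c) Ψ x⟫) := by
  rcases eq_or_lt_of_le ht with rfl | hlt
  · simp
  have hSU : UniqueDiffOn ℝ S := by
    refine uniqueDiffOn_convex hS ((nonempty_Ioo.2 hlt).mono ?_)
    rw [← interior_Icc]
    exact interior_mono hI
  have hderiv := stub_perturbationEnergyBalance ν S f U q u p hS hU hu
  have hEc : ContinuousOn (fun s => kineticEnergy (fun x => u s x - U x)) (Icc t₁ t₂) :=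
    fun s hs => ((hderiv s (hI hs)).continuousWithinAt).mono hI
  have hw : IsSmoothSpaceTimeOn S (fun s y => u s y - c) :=
    hu.smooth_velocity.sub (isSmoothSpaceTimeOn_const (isSmooth_const c) S)
  have hTc : ContinuousOn (fun s => ∫ x, ⟪u s x - c, convect (fun y => u s y - c) Ψ x⟫)
      (Icc t₁ t₂) :=
    ((hw.inner (hw.convect (isSmoothSpaceTimeOn_const hΨ S) hSU)).continuousOn_integral hS).mono hI
  have hRc : ContinuousOn (fun s => 2 * K * kineticEnergy (fun x => u s x - U x) +
      B * K * Real.sqrt 2 * Real.sqrt (kineticEnergy (fun x => u s x - U x))) (Icc t₁ t₂) :=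
    (continuousOn_const.mul hEc).add (continuousOn_const.mul hEc.sqrt)
  have hφi : IntegrableOn (fun s => b * -(∫ x, ⟪u s x - c, convect (fun y => u s y - c) Ψ x⟫) +
      a * (2 * K * kineticEnergy (fun x => u s x - U x) +
        B * K * Real.sqrt 2 * Real.sqrt (kineticEnergy (fun x => u s x - U x)))) (Icc t₁ t₂)
      volume :=
    ((continuousOn_const.mul hTc.neg).add (continuousOn_const.mul hRc)).integrableOn_compact
      isCompact_Icc
  have hmain := intervalIntegral.sub_le_integral_of_hasDeriv_right_of_le ht hEc
    (fun s hs => ((hderiv s (hI (Ioo_subset_Icc_self hs))).hasDerivAt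
      (mem_of_superset (Icc_mem_nhds hs.1 hs.2) hI)).hasDerivWithinAt)
    hφi (fun s hs => flux_le hν hK ha hb hbB hΦ hΨ hPT hUeq hU hu (hI (Ioo_subset_Icc_self hs)))
  have hi1 : IntervalIntegrable
      (fun s => b * -(∫ x, ⟪u s x - c, convect (fun y => u s y - c) Ψ x⟫)) volume t₁ t₂ :=
    ((hTc.neg.mono (uIcc_of_le ht).subset).intervalIntegrable (μ := volume)).const_mul b
  have hi2 : IntervalIntegrable (fun s => a * (2 * K * kineticEnergy (fun x => u s x - U x) +
      B * K * Real.sqrt 2 * Real.sqrt (kineticEnergy (fun x => u s x - U x)))) volume t₁ t₂ :=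
    ((hRc.mono (uIcc_of_le ht).subset).intervalIntegrable (μ := volume)).const_mul a
  rw [intervalIntegral.integral_add hi1 hi2, intervalIntegral.integral_const_mul,
    intervalIntegral.integral_const_mul] at hmain
  linarith

end KinematicExtraction

/-- **Kinematic extraction** (registered stub `stub_kinematicExtraction` of the line `Sketch` for
the crux `DopplerClock.QuadratureStressFloor`, stmt-AnomalousDissipation-18129). For the laminar
streak array `u_L(ν) = V e₂ + sin(2πm x₁)(a cos 2πn x₂ + b sin 2πn x₂) e₀` (`a = Fνκ²/D`,
`b = FV(2πn)/D`, `D = V²(2πn)² + ν²κ⁴`) of the force `F sin(2πm x₁) cos(2πn x₂) e₀` and every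
classical solution `(u, p)` of `NS_ν(f)` on a convex time set `S ⊇ [t₁, t₂]`, with `w' = u − u_L`,
`E' = ½‖w'‖₂²`, `w = u − V e₂`:
`E'(t₂) − E'(t₁) − a∫(C₁E' + C₂√E') ≤ b∫(−T_s(w))`, `T_s(w) = ∫⟪w,(w·∇)Ψ_s⟫`, with
`C₁ = 4π(m+n)`, `C₂ = (F/(2πnV))·2π(m+n)·√2` depending on the design only
(`KinematicExtraction.integrated` with `U = u_L` from `dopplerClock_laminarStreaks_proof`, the
pattern transport facts `stub_patternTransportFacts`, and `0 ≤ a`, `0 ≤ b ≤ F/(2πnV)` since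
`D ≥ V²(2πn)²`). [folklore] -/
theorem stub_kinematicExtraction :
    ∀ (F V : ℝ) (m n : ℕ), 0 < F → 0 < V → 0 < m → 0 < n →
      ∃ C₁ C₂ : ℝ, ∀ (ν a b : ℝ) (uL : UnitAddTorus (Fin 3) → EuclideanSpace ℝ (Fin 3)), 0 < ν →
        a = F * ν * ((2 * Real.pi) ^ 2 * ((m : ℝ) ^ 2 + (n : ℝ) ^ 2)) / (V ^ 2 * (2 * Real.pi * n) ^ 2 + ν ^ 2 * ((2 * Real.pi) ^ 2 * ((m : ℝ) ^ 2 + (n : ℝ) ^ 2)) ^ 2) →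
        b = F * V * (2 * Real.pi * n) / (V ^ 2 * (2 * Real.pi * n) ^ 2 + ν ^ 2 * ((2 * Real.pi) ^ 2 * ((m : ℝ) ^ 2 + (n : ℝ) ^ 2)) ^ 2) →
        uL = (fun (x : UnitAddTorus (Fin 3)) => V • EuclideanSpace.single (2 : Fin 3) (1 : ℝ) +
              ((UnitAddTorus.mFourier (Pi.single (1 : Fin 3) (m : ℤ)) x).im *
                (a * (UnitAddTorus.mFourier (Pi.single (2 : Fin 3) (n : ℤ)) x).re +
                  b * (UnitAddTorus.mFourier (Pi.single (2 : Fin 3) (n : ℤ)) x).im)) •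
                EuclideanSpace.single (0 : Fin 3) (1 : ℝ)) →
        ∀ (S : Set ℝ) (t₁ t₂ : ℝ) (u : ℝ → UnitAddTorus (Fin 3) → EuclideanSpace ℝ (Fin 3))
          (p : ℝ → UnitAddTorus (Fin 3) → ℝ), t₁ ≤ t₂ → Convex ℝ S → Set.Icc t₁ t₂ ⊆ S →
          Literature.Analysis.FunctionSpaces.Torus.IsClassicalNSSolutionOn S ν (fun _ => (fun (x : UnitAddTorus (Fin 3)) => (F * (UnitAddTorus.mFourier (Pi.single (1 : Fin 3) (m : ℤ)) x).im * (UnitAddTorus.mFourier (Pi.single (2 : Fin 3) (n : ℤ)) x).re) • EuclideanSpace.single (0 : Fin 3) (1 : ℝ))) u p →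
          Literature.Analysis.FunctionSpaces.Torus.kineticEnergy (fun x => u t₂ x - uL x) -
              Literature.Analysis.FunctionSpaces.Torus.kineticEnergy (fun x => u t₁ x - uL x) -
              a * ∫ t in t₁..t₂,
                (C₁ * Literature.Analysis.FunctionSpaces.Torus.kineticEnergy (fun x => u t x - uL x) +
                  C₂ * Real.sqrt (Literature.Analysis.FunctionSpaces.Torus.kineticEnergy (fun x => u t x - uL x)))
            ≤ b * ∫ t in t₁..t₂,
                -(∫ x, inner ℝ (u t x - V • EuclideanSpace.single (2 : Fin 3) (1 : ℝ))
                  (Literature.Analysis.FunctionSpaces.Torus.convect (fun y => u t y - V • EuclideanSpace.single (2 : Fin 3) (1 : ℝ)) (fun (y : UnitAddTorus (Fin 3)) => ((UnitAddTorus.mFourier (Pi.single (1 : Fin 3) (m : ℤ)) y).im * (UnitAddTorus.mFourier (Pi.single (2 : Fin 3) (n : ℤ)) y).im) • EuclideanSpace.single (0 : Fin 3) (1 : ℝ)) x)) := by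
  intro F V m n hF hV _hm hn
  refine ⟨2 * (2 * Real.pi * ((m : ℝ) + (n : ℝ))),
    F / (V * (2 * Real.pi * n)) * (2 * Real.pi * ((m : ℝ) + (n : ℝ))) * Real.sqrt 2,
    fun ν a b uL hν ha hb huL S t₁ t₂ u p ht hS hI hu => ?_⟩
  subst huL
  -- the laminar streak array is a steady classical solution with zero pressure
  obtain ⟨hL, -, -⟩ := dopplerClock_laminarStreaks_proof F V ν m n hV hν hn
  rw [← ha, ← hb] at hL
  have ha0 : 0 ≤ a := by
    rw [ha]
    positivity
  have hb0 : 0 ≤ b := by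
    rw [hb]
    positivity
  -- `b = FV(2πn)/D ≤ F/(2πnV)` since `D ≥ V²(2πn)²`
  have hbB : b ≤ F / (V * (2 * Real.pi * n)) := by
    rw [hb]
    calc _ ≤ F * V * (2 * Real.pi * n) / (V ^ 2 * (2 * Real.pi * n) ^ 2) :=
          div_le_div_of_nonneg_left (by positivity) (by positivity)
            (le_add_of_nonneg_right (by positivity))
      _ = F / (V * (2 * Real.pi * n)) := by
          rw [div_eq_div_iff (by positivity) (by positivity)]
          ring
  exact KinematicExtraction.integrated (K := 2 * Real.pi * ((m : ℝ) + (n : ℝ)))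
    (B := F / (V * (2 * Real.pi * n))) hν.le (by positivity) ha0 hb0 hbB
    (DopplerStreaks.sinCos_regular m n).1 (DopplerWork.pattern_regular m n).1
    (stub_patternTransportFacts m n)
    (fun x => by
      simp only [smul_smul, ← add_smul]
      congr 2
      ring)
    hL hu ht hS hI

end Summit.AnomalousDissipation.AnomalousDissipation.Theorems

end
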